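import Mathlib.Algebra.Module.ZLattice.Basic
import Mathlib.LinearAlgebra.FreeModule.PID
import Mathlib.Topology.Algebra.Module.FiniteDimension
import HarnessLib

/-!
# A finitely generated subgroup of rank at most `dim V` spanning `V` is a full lattice

Topic `Algebra/Module`; namespace `Literature.Algebra.Module`. Theorems only (no definition, no
named fact, no `sorry`).

Let `V` be a finite-dimensional real vector space, `n = dim_ℝ V`, and `L ⊆ V` a `ℤ`-submodule
(= additive subgroup). Mathlib proves the implications *lattice ⇒ finitely generated, free,
of rank `n`* (`ZLattice.FG`, `ZLattice.module_free`, `ZLattice.rank`) and that the `ℤ`-span of a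
real basis is a lattice (`ZSpan` instances). This file proves the CONVERSE criterion used to
recognise period lattices:

* `exists_basis_span_eq_of_fg_of_finrank_le` — if `L` is finitely generated, `finrank ℤ L ≤ n` and
  `L` spans `V` over `ℝ`, then `L = span_ℤ (b₁, …, bₙ)` for a real BASIS `b` of `V`
  (a finitely generated torsion-free abelian group is free, of some rank `r ≤ n`; a `ℤ`-basis of `L`
  spans `V` over `ℝ`, so `r ≥ n`, hence `r = n` and the `ℤ`-basis is a real basis);
* consequences: `finrank_eq_of_fg_of_finrank_le` (`finrank ℤ L = n`),
  `exists_discreteTopology_isZLattice_of_fg_of_finrank_le` (`L` is discrete and `IsZLattice ℝ L`),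
  and the PERIOD-MATRIX form `exists_continuousLinearEquiv_of_fg_of_finrank_le`: there is a real
  linear isomorphism `Φ : ℝⁿ ≃ V` with `Φ(ℤⁿ) = L` — exactly the datum from which
  `Literature.Geometry.Kaehler.ComplexTorus Φ` presents the torus `V/L`;
* variants with the rank hypothesis phrased as a bound on `ℤ`-linearly independent families in `L`
  (`exists_basis_span_eq_of_fg_of_linearIndependent_le`) and for the range of a `ℤ`-linear map from
  a finite `ℤ`-module of rank `≤ n` (`exists_basis_span_eq_range_of_finrank_le`), and the
  `AddSubgroup` spelling.

All three hypotheses are needed: `ℤ[√2] ⊂ ℝ` is finitely generated and spans but has rank `2 > 1`;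
`ℤ[1/2] ⊂ ℝ` has rank `1` and spans but is not finitely generated; neither is discrete.

Source: the notion of (complete) lattice and its characterisation, J. Neukirch, *Algebraic Number
Theory* (1999), Ch. I §4, Definition (4.1) and Proposition (4.2); H. Lange, Ch. Birkenhake,
*Complex Abelian Varieties* (1992), §1.1 (a lattice in `ℂ^g` is a discrete subgroup of maximal
rank `2g`, equivalently a free abelian group of rank `2g` spanning `ℂ^g` over `ℝ`).
-/

noncomputable section

open Module Submodule

namespace Literature.Algebra.Module

section Algebra

variable {E : Type*} [AddCommGroup E] [Module ℝ E]

/-- **A finitely generated subgroup of rank `≤ dim V` spanning `V` is the `ℤ`-span of a real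
basis.** If `L ⊆ V` is a finitely generated `ℤ`-submodule of a finite-dimensional real vector space
with `finrank ℤ L ≤ finrank ℝ V` and `span_ℝ L = V`, then `L = span_ℤ (range b)` for a real basis
`b` of `V` indexed by `Fin (finrank ℝ V)` (so `L` is a complete lattice in the sense of Neukirch,
Def. (4.1)). [cite: NeukirchANT1999, Ch. I §4 Def. (4.1) and Prop. (4.2)] -/
theorem exists_basis_span_eq_of_fg_of_finrank_le (L : Submodule ℤ E) (hfg : L.FG)
    (hrk : finrank ℤ L ≤ finrank ℝ E) (hsp : span ℝ (L : Set E) = ⊤) :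
    ∃ b : Basis (Fin (finrank ℝ E)) ℝ E, span ℤ (Set.range b) = L := by
  haveI : IsAddTorsionFree E := IsAddTorsionFree.of_isTorsionFree ℝ E
  haveI : Module.Finite ℤ L := Module.Finite.iff_fg.mpr hfg
  -- a `ℤ`-basis of the free module `L`, read in `E`
  set r : ℕ := finrank ℤ L with hr_def
  let bZ : Basis (Fin r) ℤ L := Module.finBasis ℤ L
  let v : Fin r → E := fun i ↦ (bZ i : E)
  -- its `ℤ`-span is `L`
  have hvL : span ℤ (Set.range v) = L := by
    have hrange : Set.range v = L.subtype '' Set.range bZ := by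
      rw [← Set.range_comp]
      rfl
    rw [hrange, ← Submodule.map_span, bZ.span_eq, Submodule.map_subtype_top]
  -- its `ℝ`-span is everything
  have hvtop : span ℝ (Set.range v) = ⊤ := by
    rw [← Submodule.span_span_of_tower ℤ ℝ (Set.range v), hvL, hsp]
  -- hence `n ≤ r`, so `r = n`
  have hnr : finrank ℝ E ≤ r := by
    have h := finrank_range_le_card (R := ℝ) v
    rw [Set.finrank, hvtop, finrank_top, Fintype.card_fin] at h
    exact h
  have hcard : Fintype.card (Fin r) = finrank ℝ E := by
    rw [Fintype.card_fin]; exact le_antisymm hrk hnr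
  -- a spanning family of `finrank` vectors is a basis
  let b₀ : Basis (Fin r) ℝ E := basisOfTopLeSpanOfCardEqFinrank v hvtop.ge hcard
  have hb₀ : ⇑b₀ = v := coe_basisOfTopLeSpanOfCardEqFinrank v hvtop.ge hcard
  refine ⟨b₀.reindex (finCongr (by simpa using hcard)), ?_⟩
  rw [b₀.range_reindex, hb₀, hvL]

/-- The rank of such a subgroup is exactly `dim V`. [cite: NeukirchANT1999, Ch. I §4 Def. (4.1) and Prop. (4.2)] -/
theorem finrank_eq_of_fg_of_finrank_le (L : Submodule ℤ E) (hfg : L.FG)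
    (hrk : finrank ℤ L ≤ finrank ℝ E) (hsp : span ℝ (L : Set E) = ⊤) :
    finrank ℤ L = finrank ℝ E := by
  obtain ⟨b, hb⟩ := exists_basis_span_eq_of_fg_of_finrank_le L hfg hrk hsp
  haveI : IsAddTorsionFree E := IsAddTorsionFree.of_isTorsionFree ℝ E
  subst hb
  rw [finrank_eq_card_basis ((b.restrictScalars ℤ).reindexRange.reindex
      (Equiv.ofInjective _ (b.restrictScalars ℤ).injective).symm)]
  simp

/-- Variant: the rank hypothesis as a bound on `ℤ`-linearly independent families of `L` — if every
`ℤ`-linearly independent family in the finitely generated spanning subgroup `L` has at most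
`dim V` members, then `L` is the `ℤ`-span of a real basis. [cite: NeukirchANT1999, Ch. I §4 Def. (4.1) and Prop. (4.2)] -/
theorem exists_basis_span_eq_of_fg_of_linearIndependent_le (L : Submodule ℤ E) (hfg : L.FG)
    (hli : ∀ (m : ℕ) (v : Fin m → L), LinearIndependent ℤ v → m ≤ finrank ℝ E)
    (hsp : span ℝ (L : Set E) = ⊤) :
    ∃ b : Basis (Fin (finrank ℝ E)) ℝ E, span ℤ (Set.range b) = L := by
  haveI : IsAddTorsionFree E := IsAddTorsionFree.of_isTorsionFree ℝ E
  haveI : Module.Finite ℤ L := Module.Finite.iff_fg.mpr hfg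
  refine exists_basis_span_eq_of_fg_of_finrank_le L hfg ?_ hsp
  exact hli _ (Module.finBasis ℤ L) (Module.finBasis ℤ L).linearIndependent

/-- Variant: the RANGE of a `ℤ`-linear map `f : M → V` from a finite `ℤ`-module of rank
`finrank ℤ M ≤ dim V` whose image spans `V` is the `ℤ`-span of a real basis (e.g. `M = H₁(X; ℤ)`
or the abelianised fundamental group, `f` a period map). [cite: NeukirchANT1999, Ch. I §4 Def. (4.1) and Prop. (4.2)] -/
theorem exists_basis_span_eq_range_of_finrank_le {M : Type*} [AddCommGroup M] [Module.Finite ℤ M]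
    (f : M →ₗ[ℤ] E) (hrk : finrank ℤ M ≤ finrank ℝ E)
    (hsp : span ℝ (LinearMap.range f : Set E) = ⊤) :
    ∃ b : Basis (Fin (finrank ℝ E)) ℝ E, span ℤ (Set.range b) = LinearMap.range f := by
  refine exists_basis_span_eq_of_fg_of_finrank_le (LinearMap.range f)
    (Module.Finite.iff_fg.mp inferInstance) ((LinearMap.finrank_range_le f).trans hrk) hsp

end Algebra

section Topology

variable {E : Type*} [NormedAddCommGroup E] [NormedSpace ℝ E]

/-- **Lattice criterion.** A finitely generated subgroup `L` of a finite-dimensional real normed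
space with `finrank ℤ L ≤ dim V` and `span_ℝ L = V` is DISCRETE and a full `ℤ`-lattice
(`IsZLattice ℝ L`); with Mathlib's `ZLattice.FG` / `ZLattice.rank` this is the equivalence
"lattice ⟺ discrete" of Neukirch, Prop. (4.2), for spanning subgroups. [cite: NeukirchANT1999, Ch. I §4 Prop. (4.2)] -/
theorem exists_discreteTopology_isZLattice_of_fg_of_finrank_le (L : Submodule ℤ E) (hfg : L.FG)
    (hrk : finrank ℤ L ≤ finrank ℝ E) (hsp : span ℝ (L : Set E) = ⊤) :
    ∃ _ : DiscreteTopology L, IsZLattice ℝ L := by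
  obtain ⟨b, hb⟩ := exists_basis_span_eq_of_fg_of_finrank_le L hfg hrk hsp
  subst hb
  exact ⟨inferInstance, inferInstance⟩

/-- Discreteness alone, as a `DiscreteTopology` conclusion. [cite: NeukirchANT1999, Ch. I §4 Prop. (4.2)] -/
theorem discreteTopology_of_fg_of_finrank_le (L : Submodule ℤ E) (hfg : L.FG)
    (hrk : finrank ℤ L ≤ finrank ℝ E) (hsp : span ℝ (L : Set E) = ⊤) :
    DiscreteTopology L :=
  (exists_discreteTopology_isZLattice_of_fg_of_finrank_le L hfg hrk hsp).1

/-- **Period-matrix form.** Under the same hypotheses there is a continuous real-linear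
isomorphism `Φ : ℝⁿ ≃ V` (`n = dim V`) carrying `ℤⁿ` onto `L`: `x ∈ L ↔ ∃ v ∈ ℤⁿ, Φ v = x`.
This is the datum `Φ` of `Literature.Geometry.Kaehler.ComplexTorus Φ` presenting `V/L` (a period
matrix, Lange–Birkenhake §1.1.1). [cite: LangeBirkenhake1992, §1.1.1] -/
theorem exists_continuousLinearEquiv_of_fg_of_finrank_le (L : Submodule ℤ E) (hfg : L.FG)
    (hrk : finrank ℤ L ≤ finrank ℝ E) (hsp : span ℝ (L : Set E) = ⊤) :
    ∃ Φ : (Fin (finrank ℝ E) → ℝ) ≃L[ℝ] E,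
      ∀ x : E, x ∈ L ↔ ∃ v : Fin (finrank ℝ E) → ℤ, Φ (fun i ↦ (v i : ℝ)) = x := by
  obtain ⟨b, hb⟩ := exists_basis_span_eq_of_fg_of_finrank_le L hfg hrk hsp
  refine ⟨b.equivFun.symm.toContinuousLinearEquiv, fun x ↦ ?_⟩
  rw [← hb, Submodule.mem_span_range_iff_exists_fun]
  refine exists_congr fun v ↦ ?_
  rw [LinearEquiv.coe_toContinuousLinearEquiv', Basis.equivFun_symm_apply]
  simp only [Int.cast_smul_eq_zsmul ℝ]

/-- The lattice vectors are exactly the images of the integer vectors: `Φ '' ℤⁿ = L` (set form of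
`exists_continuousLinearEquiv_of_fg_of_finrank_le`). [cite: LangeBirkenhake1992, §1.1.1] -/
theorem exists_continuousLinearEquiv_image_eq_of_fg_of_finrank_le (L : Submodule ℤ E) (hfg : L.FG)
    (hrk : finrank ℤ L ≤ finrank ℝ E) (hsp : span ℝ (L : Set E) = ⊤) :
    ∃ Φ : (Fin (finrank ℝ E) → ℝ) ≃L[ℝ] E,
      Φ '' Set.range (fun v : Fin (finrank ℝ E) → ℤ ↦ fun i ↦ (v i : ℝ)) = (L : Set E) := by
  obtain ⟨Φ, hΦ⟩ := exists_continuousLinearEquiv_of_fg_of_finrank_le L hfg hrk hsp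
  refine ⟨Φ, Set.ext fun x ↦ ?_⟩
  simp only [Set.mem_image, Set.mem_range, exists_exists_eq_and, SetLike.mem_coe, hΦ]

/-- `AddSubgroup` spelling of the lattice criterion: a finitely generated additive subgroup `Λ` of
a finite-dimensional real normed space, of rank `finrank ℤ Λ ≤ dim V` and spanning `V`, is the
image of `ℤⁿ` under a continuous real-linear isomorphism `Φ : ℝⁿ ≃ V`. [cite: NeukirchANT1999, Ch. I §4 Def. (4.1) and Prop. (4.2)] -/
theorem _root_.AddSubgroup.exists_continuousLinearEquiv_of_fg_of_finrank_le (Λ : AddSubgroup E)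
    (hfg : Λ.FG) (hrk : finrank ℤ Λ ≤ finrank ℝ E)
    (hsp : span ℝ (Λ : Set E) = ⊤) :
    ∃ Φ : (Fin (finrank ℝ E) → ℝ) ≃L[ℝ] E,
      ∀ x : E, x ∈ Λ ↔ ∃ v : Fin (finrank ℝ E) → ℤ, Φ (fun i ↦ (v i : ℝ)) = x := by
  have hfg' : (AddSubgroup.toIntSubmodule Λ).FG := by
    rw [Submodule.fg_iff_addSubgroup_fg, AddSubgroup.toIntSubmodule_toAddSubgroup]; exact hfg
  obtain ⟨Φ, hΦ⟩ := Literature.Algebra.Module.exists_continuousLinearEquiv_of_fg_of_finrank_le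
    (AddSubgroup.toIntSubmodule Λ) hfg' hrk hsp
  exact ⟨Φ, fun x ↦ by rw [← hΦ x]; rfl⟩

end Topology

end Literature.Algebra.Module
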